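import Summits.Ventures.WeilGRH.DualTrigKernelLatticeRegimes
import HarnessLib

/-!
# Format D-K v3 (multi-lattice): soundness — the certificate function is nonnegative; the family theorem

Cell `rh-explicit`, WEIL TRACK — GRH ARM, route B (weil-grh-3).  From `DKCert3.checkL = true`:

* `DKCert3.P3_nonneg_of_checkL` — `0 ≤ Re ψ(σ' + iρθ) + (log q − log π) + Σ_t val_t(θ)` for every real
  `θ`: cells on the covered range; the base periodic part `≥ mT` and every lattice part `T_p ≥ mT_p`
  EVERYWHERE by period duty and periodicity (`2π` resp. `2π/r_p` in `θ`); beyond the covered range the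
  tail inequality `tailOK3` with `Re ψ` increasing in `|y|`, the incommensurable window terms split into
  the lattice parts and the rest (`−B_rest`);
* `DKCert3.sound_familyL`, `DKCert3.weilPositivityOnChar_family_of_checkL` — the multiplier inequality
  and the rung `WeilPositivityOnChar χ (log (N+1) / 2)` for EVERY modulus `q ≥ c.base.q` and every
  Dirichlet character with the claimed parity and window values (one kernel certificate = one theorem for
  the key group at every conductor above the threshold), via `weilPositivityOnChar_of_trigDual` with the
  atoms of all lattices.

Everything here is PROVED; no named facts, no `sorry`, no kernel evaluation.
-/

noncomputable section

open Finset Real Complex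

namespace Summit.Ventures.WeilGRH

open Literature.Analysis.ValidatedNumerics.NumericsMP
open Literature.NumberTheory.LFunctions
open DualTrigTaylor DigammaVertical

namespace DKCert3

variable {c : DKCert3}

/-! ### The certificate function is nonnegative -/

/-- **The certificate function is `≥ 0` everywhere, from the frame flags and the cell bounds** (the cell
checker enters only through `CellBounds`). [folklore] -/
theorem P3_nonneg_of_partsCB (hconsts : c.base.constsOK = true) (hvals : c.base.valsOK = true)
    (hblocks : c.base.blocksOK = true) (hlats : c.latsOK = true) (hcover : c.latCoverOK = true)
    (htail : c.tailOK3 = true) (hcb : CellBounds c) (θ : ℝ) : 0 ≤ c.P3 θ := by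
  obtain ⟨hS, hp0, hD, _, hR, _, hpi, hlog, hrho, hC⟩ := DKCert.constsOK_sound hconsts
  obtain ⟨hρ, hρω⟩ := DKCert.rhoR_pos_and_mul hp0 hD
  obtain ⟨hnd, hrest, hlat⟩ := latsOK_sound hlats hS hlog
  have hratm : ∀ l ∈ c.lats, MI.mem c.base.S (c.ratR l) l.rI := fun l hl ↦ (hlat l hl).2.2.2.2.1
  have hF := terms3_repr hS hpi hlog hp0 hvals hratm
  have hSr : (0 : ℝ) < c.base.S := by exact_mod_cast hS
  obtain ⟨hbs, hchain, b0, bl, h0, hl, hfirst, hlast⟩ := DKCert.blocksOK_sound hblocks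
  obtain ⟨b0', bl', h0', hl', hcov⟩ := latCoverOK_sound hcover
  rw [h0] at h0'; rw [hl] at hl'
  obtain rfl : b0 = b0' := Option.some.inj h0'
  obtain rfl : bl = bl' := Option.some.inj hl'
  have hb0 : b0 ∈ c.base.blocks := List.mem_of_mem_head? h0
  have hbl : bl ∈ c.base.blocks := List.mem_of_mem_getLast? hl
  have hMc0 : (0 : ℝ) < b0.Mc := by exact_mod_cast (hbs b0 hb0).1
  have hMcl : (0 : ℝ) < bl.Mc := by exact_mod_cast (hbs bl hbl).1
  have hend : π ≤ DKCert.bEnd bl := by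
    unfold DKCert.bEnd; rw [le_div_iff₀ hMcl]
    have : (bl.Mc : ℝ) ≤ 2 * ((bl.j0 : ℝ) + bl.n) := by exact_mod_cast hlast
    nlinarith [Real.pi_pos]
  have hstart0 : DKCert.bStart b0 ≤ 0 := by
    unfold DKCert.bStart
    have : (b0.j0 : ℝ) ≤ 0 := by
      split_ifs at hfirst with he
      · exact_mod_cast hfirst
      · have : (2 * b0.j0 : ℝ) ≤ -(b0.Mc : ℝ) := by exact_mod_cast hfirst
        linarith
    have : 2 * π * (b0.j0 : ℝ) ≤ 0 := by nlinarith [Real.pi_pos]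
    exact div_nonpos_of_nonpos_of_nonneg this hMc0.le
  have hstartπ : c.base.even = false → DKCert.bStart b0 ≤ -π := by
    intro he; simp only [he] at hfirst
    unfold DKCert.bStart; rw [div_le_iff₀ hMc0]
    have : (2 * b0.j0 : ℝ) ≤ -(b0.Mc : ℝ) := by exact_mod_cast hfirst
    nlinarith [Real.pi_pos]
  -- evenness data
  have hevenB : c.base.even = true → ∀ t ∈ c.terms3R, t.B = 0 := by
    intro he t ht
    unfold terms3R at ht
    rw [List.mem_append] at ht
    rcases ht with ht | ht
    · exact DKCert.termsR_B_zero hvals he t ht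
    · exact latJoinR_B_zero c.lats (fun l hl ↦ (hlat l hl).2.2.2.2.2.2.1 he) t ht
  -- (1) the base periodic part everywhere
  have hint : ∀ rt ∈ DKCert.cList c.terms3 c.terms3R, ∃ k : ℤ, rt.κ = k := by
    refine DKCert.cList_int c.terms3 c.terms3R hF ?_
    intro t ht hcomm
    unfold terms3 at ht
    rw [List.mem_append] at ht
    rcases ht with ht | ht
    · exact DKCert.isInt_of_comm t ht hcomm
    · rw [latJoin_comm c.lats t ht] at hcomm; exact absurd hcomm (by decide)
  have hT : ∀ θ : ℝ, (c.base.mT : ℝ) / c.base.S ≤ sumVal (DKCert.cList c.terms3 c.terms3R) θ := by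
    intro θ
    obtain ⟨k, hk1, hk2⟩ := exists_reduce (2 * π) (by positivity) θ
    set θ' : ℝ := θ - k * (2 * π) with hθ'
    have hθ'1 : -π ≤ θ' := by linarith
    have hθ'2 : θ' ≤ π := by linarith
    have hper : sumVal (DKCert.cList c.terms3 c.terms3R) θ = sumVal (DKCert.cList c.terms3 c.terms3R) θ' := by
      rw [hθ', show θ - k * (2 * π) = θ + (-k : ℤ) * (2 * π) by push_cast; ring]
      exact (DKCert.sumVal_add_int_mul _ hint θ (-k)).symm
    rw [hper]
    by_cases he : c.base.even = true
    · have hevenC : ∀ t ∈ DKCert.cList c.terms3 c.terms3R, t.B = 0 :=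
        fun t ht ↦ hevenB he t (DKCert.mem_of_mem_cList _ _ t ht)
      rcases le_total 0 θ' with hpos | hneg
      · exact baseT_ge_of_covered hblocks hcb h0 hl (hstart0.trans hpos)
          (hθ'2.trans hend) hθ'1 hθ'2
      · rw [← sumVal_neg _ hevenC θ']
        exact baseT_ge_of_covered hblocks hcb h0 hl (by linarith) (by linarith)
          (by linarith) (by linarith)
    · rw [Bool.not_eq_true] at he
      exact baseT_ge_of_covered hblocks hcb h0 hl ((hstartπ he).trans hθ'1)
        (hθ'2.trans hend) hθ'1 hθ'2
  -- (2) every lattice part everywhere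
  have hL : ∀ l ∈ c.lats, ∀ θ : ℝ, (l.mT : ℝ) / c.base.S ≤ sumVal (c.latTermsR l) θ := by
    intro l hll θ
    obtain ⟨hp, _, hDl, hlo, hr, _, hevl, _⟩ := hlat l hll
    obtain ⟨hrpos, _⟩ := ratR_pos_and_mul hp0 hD hp hDl
    set P : ℝ := 2 * π / c.ratR l with hPdef
    have hP : 0 < P := by positivity
    obtain ⟨m, hm1, hm2⟩ := exists_reduce P hP θ
    set θ' : ℝ := θ - m * P with hθ'
    have hP2 : P / 2 = π / c.ratR l := by rw [hPdef]; ring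
    rw [hP2] at hm1 hm2
    have hper : sumVal (c.latTermsR l) θ = sumVal (c.latTermsR l) θ' := by
      rw [hθ', show θ - m * P = θ + (-m : ℤ) * (2 * π / c.ratR l) by rw [hPdef]; push_cast; ring]
      exact (latT_periodic hp0 hD hvals hp hDl θ (-m)).symm
    rw [hper]
    -- the zone `|θ'| ≤ π/r` lies in the covered range
    have hlor : (0 : ℝ) < l.rI.lo := by exact_mod_cast hlo
    have hzone : π / c.ratR l ≤ π * c.base.S / l.rI.lo := by
      rw [div_le_div_iff₀ hrpos hlor]; nlinarith [Real.pi_pos, hr.1]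
    obtain ⟨hcovE, hcovS⟩ := hcov l hll
    have hendl : π * c.base.S / l.rI.lo ≤ DKCert.bEnd bl := by
      unfold DKCert.bEnd
      rw [div_le_div_iff₀ hlor hMcl]
      have : ((bl.Mc : ℤ) : ℝ) * c.base.S ≤ 2 * ((bl.j0 : ℝ) + bl.n) * l.rI.lo := by exact_mod_cast hcovE
      push_cast at this; nlinarith [Real.pi_pos]
    by_cases he : c.base.even = true
    · have hevenL := latTermsR_B_zero hvals he (hevl he) (l := l)
      rcases le_total 0 θ' with hpos | hneg
      · exact latT_ge_of_covered hblocks hcb hS h0 hl hll hr hlo (hstart0.trans hpos)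
          (hm2.trans (hzone.trans hendl)) hm1 hm2
      · rw [← sumVal_neg _ hevenL θ']
        exact latT_ge_of_covered hblocks hcb hS h0 hl hll hr hlo (by linarith)
          (by linarith) (by linarith) (by linarith)
    · rw [Bool.not_eq_true] at he
      rcases hcovS with hcovS | hcovS
      · rw [he] at hcovS; exact absurd hcovS (by decide)
      have hstartl : DKCert.bStart b0 ≤ -(π * c.base.S / l.rI.lo) := by
        unfold DKCert.bStart
        rw [← neg_div, div_le_div_iff₀ hMc0 hlor]
        have : 2 * (b0.j0 : ℝ) * l.rI.lo ≤ -((b0.Mc : ℝ) * c.base.S) := by exact_mod_cast hcovS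
        nlinarith [Real.pi_pos]
      exact latT_ge_of_covered hblocks hcb hS h0 hl hll hr hlo
        (hstartl.trans ((neg_le_neg hzone).trans hm1)) (hm2.trans (hzone.trans hendl)) hm1 hm2
  -- (3) the tail
  have hLsum : ∀ θ : ℝ, ((c.mTsum : ℤ) : ℝ) / c.base.S ≤ (c.lats.map fun l ↦ sumVal (c.latTermsR l) θ).sum := by
    intro θ
    unfold mTsum
    have : ∀ ls : List DKLat, (∀ l ∈ ls, l ∈ c.lats) →
        (((ls.map (·.mT)).sum : ℤ) : ℝ) / c.base.S ≤ (ls.map fun l ↦ sumVal (c.latTermsR l) θ).sum := by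
      intro ls
      induction ls with
      | nil => simp
      | cons l ls ih =>
          intro hmem
          simp only [List.map_cons, List.sum_cons, Int.cast_add, add_div]
          exact add_le_add (hL l (hmem l (by simp)) θ) (ih fun l' hl' ↦ hmem l' (by simp [hl']))
    exact this c.lats fun l hl ↦ hl
  have hrestB : ∀ θ : ℝ, -(((c.bInc3 : ℤ) : ℝ) / c.base.S) ≤ sumVal c.restR θ := by
    intro θ
    obtain ⟨ws, hws⟩ := Option.isSome_iff_exists.1 hrest
    have hFr := restTerms_repr hS hpi hlog hp0 hvals hws
    unfold bInc3; rw [hws, Option.getD_some]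
    exact DKCert.neg_amp_le_sumVal hS ws c.restR hFr θ
  have hsplit : ∀ θ : ℝ, sumVal c.terms3R θ = sumVal (DKCert.cList c.terms3 c.terms3R) θ +
      ((c.lats.map fun l ↦ sumVal (c.latTermsR l) θ).sum + sumVal c.restR θ) := by
    intro θ
    have e1 := DKCert.sumVal_cList c.terms3 c.terms3R hF θ
    have e2 : DKCert.ncList c.terms3 c.terms3R = DKCert.ncList c.base.terms c.base.termsR ++ c.latJoinR c.lats := by
      unfold terms3 terms3R
      exact DKCert.ncList_append_nc _ _ (DKCert.terms_repr hS hpi hlog hp0 hvals) _ _ (latJoin_repr hS c.lats hratm)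
        (latJoin_comm c.lats)
    have e3 := DKCert.sumVal_ncList_base hvals θ
    have e4 := sumVal_ncVals_split hnd θ
    rw [e2, DKCert.sumVal_append, e3] at e1
    unfold ncVals at e4
    linarith [e1, e4]
  unfold tailOK3 at htail
  simp only [h0, hl, Bool.and_eq_true, Bool.or_eq_true] at htail
  obtain ⟨htl, htf⟩ := htail
  have tail_of : ∀ (Mc : ℕ) (jj : ℤ), 1 ≤ Mc →
      (match c.base.psiTailLo Mc jj with
        | some v => decide (0 ≤ v + c.base.constI.lo - c.bInc3 + c.base.mT + c.mTsum) | none => false) = true →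
      ∀ θ : ℝ, 2 * π * |(jj : ℝ)| / Mc ≤ |θ| → 0 ≤ c.P3 θ := by
    intro Mc jj hMc h θ hθ
    cases hv : c.base.psiTailLo Mc jj with
    | none => simp [hv] at h
    | some v =>
      simp only [hv, decide_eq_true_eq] at h
      have hψ := DKCert.psiTailLo_sound hS hpi hrho hρ hMc jj hv hθ
      have hCr : ((c.base.constI.lo : ℤ) : ℝ) / c.base.S ≤ c.base.constR := DKCert.lo_le hS hC
      have hz : (0 : ℝ) ≤ ((v + c.base.constI.lo - c.bInc3 + c.base.mT + c.mTsum : ℤ) : ℝ) / c.base.S := by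
        have : (0 : ℝ) ≤ ((v + c.base.constI.lo - c.bInc3 + c.base.mT + c.mTsum : ℤ) : ℝ) := by exact_mod_cast h
        positivity
      unfold P3; rw [hsplit θ]
      push_cast at hz
      have := hT θ; have := hLsum θ; have := hrestB θ
      rw [add_div, add_div, sub_div, add_div] at hz
      linarith
  -- (4) every θ: first for θ ≥ bStart b0
  have hge : ∀ θ : ℝ, DKCert.bStart b0 ≤ θ → 0 ≤ c.P3 θ := by
    intro θ hθ
    rcases le_total θ (DKCert.bEnd bl) with hle | hgt
    · exact P3_nonneg_of_covered hblocks hcb h0 hl hθ hle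
    · refine tail_of bl.Mc (bl.j0 + bl.n) (hbs bl hbl).1 htl θ ?_
      have hjj : (0 : ℝ) ≤ ((bl.j0 + bl.n : ℤ) : ℝ) := by
        have : 0 < DKCert.bEnd bl := lt_of_lt_of_le Real.pi_pos hend
        unfold DKCert.bEnd at this
        have := (div_pos_iff_of_pos_right hMcl).1 this
        push_cast; nlinarith [Real.pi_pos]
      rw [abs_of_nonneg hjj]
      have : DKCert.bEnd bl = 2 * π * ((bl.j0 + bl.n : ℤ) : ℝ) / bl.Mc := by unfold DKCert.bEnd; push_cast; ring
      rw [← this]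
      exact hgt.trans (le_abs_self θ)
  rcases le_total (DKCert.bStart b0) θ with hθ | hθ
  · exact hge θ hθ
  · by_cases he : c.base.even = true
    · -- symmetry
      have hsym : c.P3 (-θ) = c.P3 θ := by
        unfold P3
        have h1 := bracket_neg (DKCert.sigR_mem (c := c.base)).2 0 (c.base.rhoR * θ)
        simp only [bracket, Finset.range_zero, Finset.sum_empty, sub_zero] at h1
        rw [show ((c.base.rhoR * -θ : ℝ) : ℂ) = ((-(c.base.rhoR * θ) : ℝ) : ℂ) by push_cast; ring, h1,
          sumVal_neg c.terms3R (hevenB he) θ]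
      rw [← hsym]
      exact hge (-θ) (by linarith)
    · rw [Bool.not_eq_true] at he
      simp only [he, Bool.false_eq_true, false_or] at htf
      refine tail_of b0.Mc b0.j0 (hbs b0 hb0).1 htf θ ?_
      simp only [he, Bool.false_eq_true, if_false] at hfirst
      have hj0 : (b0.j0 : ℝ) ≤ 0 := by
        have : (2 * b0.j0 : ℝ) ≤ -(b0.Mc : ℝ) := by exact_mod_cast hfirst
        linarith
      rw [abs_of_nonpos hj0]
      have hθ0 : θ ≤ 0 := hθ.trans hstart0
      rw [abs_of_nonpos hθ0]
      unfold DKCert.bStart at hθ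
      have : 2 * π * -(b0.j0 : ℝ) / b0.Mc = -(2 * π * b0.j0 / b0.Mc) := by ring
      rw [this]; linarith

/-! ### The family theorems -/

/-- The wrapper from `checkL`: unpack the flags, get the cell bounds from `cellsOKL`. [folklore] -/
theorem P3_nonneg_of_checkL (hc : c.checkL = true) (θ : ℝ) : 0 ≤ c.P3 θ := by
  unfold checkL frame3OK baseFrameOK at hc
  simp only [Bool.and_eq_true] at hc
  obtain ⟨⟨⟨⟨⟨⟨⟨⟨hconsts, hvals⟩, _⟩, hblocks⟩, _⟩, hlats⟩, hcover⟩, htail⟩, hcells⟩ := hc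
  obtain ⟨hS, _, _, _, _, _, _, hlog, _, _⟩ := DKCert.constsOK_sound hconsts
  obtain ⟨_, _, hlat⟩ := latsOK_sound hlats hS hlog
  exact P3_nonneg_of_partsCB hconsts hvals hblocks hlats hcover htail
    (cellBounds_of_partsL hconsts hvals hblocks (fun l hl ↦ (hlat l hl).2.2.2.2.1)
      (fun l hl ↦ (hlat l hl).2.2.2.2.2.2.2) hcells) θ

/-- **Soundness for the whole key group, every modulus `q ≥ c.base.q`, from the frame flags and the cell
bounds.** [folklore] -/
theorem sound_familyL_of_partsCB (hconsts : c.base.constsOK = true) (hvals : c.base.valsOK = true)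
    (hnodup : c.base.valsNodup = true) (hblocks : c.base.blocksOK = true) (hlats : c.latsOK = true)
    (hcover : c.latCoverOK = true) (htail : c.tailOK3 = true) (hcb : CellBounds c)
    {q : ℕ} (hq : c.base.q ≤ q) (χ : DirichletCharacter ℂ q)
    (hpar : charParity χ = c.base.par) (hχ : ∀ val ∈ c.base.vals, χ (val.n : ZMod q) = DKCert.valZ val)
    (hχ0 : ∀ n : ℕ, n ≤ c.base.N → IsPrimePow n → ¬ Nat.Coprime n c.base.q → χ (n : ZMod q) = 0) (τ : ℝ) :
    0 ≤ weilFinitePrimeWeightChar χ c.base.N τ + trigSum c.allAtomsT τ := by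
  have hmain := P3_nonneg_of_partsCB hconsts hvals hblocks hlats hcover htail hcb (c.base.omegaR * τ)
  obtain ⟨hS, hp0, hD, _, _, _, _, hlog, _, _⟩ := DKCert.constsOK_sound hconsts
  obtain ⟨_, hρω⟩ := DKCert.rhoR_pos_and_mul hp0 hD
  obtain ⟨_, _, hlat⟩ := latsOK_sound hlats hS hlog
  unfold P3 terms3R at hmain
  have hval := DKCert.sumVal_valsR_eq_family (χ := χ) hp0 hD hvals (by
    unfold DKCert.valsNodup at hnodup; simpa using hnodup) hχ hχ0 τ
  unfold DKCert.termsR at hmain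
  rw [DKCert.sumVal_append, DKCert.sumVal_append, DKCert.sumVal_atoms, hval,
    sumVal_latJoinR_eq_trigSum hp0 hD τ c.lats (fun l hl ↦ ⟨(hlat l hl).1, (hlat l hl).2.2.1⟩)] at hmain
  unfold weilFinitePrimeWeightChar allAtomsT
  have harg : (c.base.sigR : ℂ) + ((c.base.rhoR * (c.base.omegaR * τ) : ℝ) : ℂ) * I =
      1 / 4 + (charParity χ : ℂ) / 2 + (τ : ℂ) / 2 * I := by
    rw [← mul_assoc, hρω, hpar]
    unfold DKCert.sigR
    push_cast; ring
  rw [harg] at hmain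
  unfold DKCert.constR at hmain
  have hlogq := DKCert.log_threshold_le (c := c.base) hq
  have hts : trigSum (List.map c.base.atomT c.base.atoms ++ c.latJoinT c.lats) τ =
      trigSum (List.map c.base.atomT c.base.atoms) τ + trigSum (c.latJoinT c.lats) τ := by
    simp [trigSum, List.map_append, List.sum_append]
  rw [hts]
  linarith

/-- **Soundness for the whole key group, every modulus `q ≥ c.base.q`, from `checkL`.** [folklore] -/
theorem sound_familyL (hc : c.checkL = true) {q : ℕ} (hq : c.base.q ≤ q) (χ : DirichletCharacter ℂ q)
    (hpar : charParity χ = c.base.par) (hχ : ∀ val ∈ c.base.vals, χ (val.n : ZMod q) = DKCert.valZ val)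
    (hχ0 : ∀ n : ℕ, n ≤ c.base.N → IsPrimePow n → ¬ Nat.Coprime n c.base.q → χ (n : ZMod q) = 0) (τ : ℝ) :
    0 ≤ weilFinitePrimeWeightChar χ c.base.N τ + trigSum c.allAtomsT τ := by
  unfold checkL frame3OK baseFrameOK at hc
  simp only [Bool.and_eq_true] at hc
  obtain ⟨⟨⟨⟨⟨⟨⟨⟨hconsts, hvals⟩, hnodup⟩, hblocks⟩, _⟩, hlats⟩, hcover⟩, htail⟩, hcells⟩ := hc
  obtain ⟨hS, _, _, _, _, _, _, hlog, _, _⟩ := DKCert.constsOK_sound hconsts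
  obtain ⟨_, _, hlat⟩ := latsOK_sound hlats hS hlog
  exact sound_familyL_of_partsCB hconsts hvals hnodup hblocks hlats hcover htail
    (cellBounds_of_partsL hconsts hvals hblocks (fun l hl ↦ (hlat l hl).2.2.2.2.1)
      (fun l hl ↦ (hlat l hl).2.2.2.2.2.2.2) hcells) hq χ hpar hχ hχ0 τ


/-- **The rung for the whole key group, every modulus `q ≥ c.base.q`, from `checkL`.**  If
`c.checkL = true`, then for every modulus `q ≥ c.base.q`, `q ≠ 1`, and every Dirichlet character `χ` mod `q`
of parity `c.base.par` with the claimed window values and `χ(n) = 0` at the prime powers `n ≤ N` not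
coprime to `c.base.q`: `WeilPositivityOnChar χ (log (N + 1) / 2)` — Weil positivity of `L(s, χ)` for all
smooth test functions supported in `[−log(N+1)/2, log(N+1)/2]`. [folklore] -/
theorem weilPositivityOnChar_family_of_checkL (hc : c.checkL = true) {q : ℕ} (hq : c.base.q ≤ q) (hq1 : q ≠ 1)
    (χ : DirichletCharacter ℂ q) (hpar : charParity χ = c.base.par)
    (hχ : ∀ val ∈ c.base.vals, χ (val.n : ZMod q) = DKCert.valZ val)
    (hχ0 : ∀ n : ℕ, n ≤ c.base.N → IsPrimePow n → ¬ Nat.Coprime n c.base.q → χ (n : ZMod q) = 0) :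
    WeilPositivityOnChar χ (Real.log ((c.base.N : ℝ) + 1) / 2) :=
  weilPositivityOnChar_of_trigDual hq1 χ c.base.N c.allAtomsT (allAtomsT_admissible hc)
    (sound_familyL hc hq χ hpar hχ hχ0)

end DKCert3

end Summit.Ventures.WeilGRH

end
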